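import Literature.AlgebraicGeometry.Resolution.SurfaceResolutionSigmaMaxElimination
import Literature.AlgebraicGeometry.Resolution.BlowupSequencesAppend
import Literature.AlgebraicGeometry.Resolution.BlowupReducedDimension
import Literature.AlgebraicGeometry.Resolution.QuasiExcellentBlowup
import Literature.AlgebraicGeometry.Resolution.ExcellentClosedSubschemes
import Literature.AlgebraicGeometry.Resolution.ExcellentRingsEssFiniteType
import Literature.AlgebraicGeometry.Resolution.HilbertSamuelLowerBound
import Literature.AlgebraicGeometry.Resolution.HilbertSamuelRegular
import Literature.AlgebraicGeometry.Resolution.HilbertSamuelIsolatedSingularities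
import Literature.AlgebraicGeometry.Resolution.HilbertSamuelGenericConstancyExcellent
import Summits.ResolutionOfSingularities.ResolutionOfSingularities.Theorems.HilbertSamuelEliminationSigmaMaxModificationsStubCentreSeqPackage
import Mathlib.AlgebraicGeometry.Morphisms.Proper
import Mathlib.AlgebraicGeometry.Noetherian
import HarnessLib

/-!
# `SigmaMaxModifications` (crux stmt-ResolutionOfSingularities-18506, line `Sketch`):
# stub `stub_sigmaMaxElimination_of_nuElimination` — gluing `ν`-eliminations (CJS Def. 6.14)

Stub `stub_sigmaMaxElimination_of_nuElimination` of the lead skeleton `Sketch` for the crux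
`Summit.ResolutionOfSingularities.ResolutionOfSingularities.Theses.HilbertSamuelElimination.SigmaMaxModifications`:
the glued named fact `CossartJannsenSaito2020_sigmaMaxElimination` (Cossart–Jannsen–Saito, LNM 2270,
Def. 6.15 with Thm. 6.28 and Thm. 3.10 (1): a blow-up sequence with centres over `X_max(2)`,
`H²` non-increasing, killing every maximal value of `Σ_X(2)`) FOLLOWS from the `ν`-wise named
fact `CossartJannsenSaito2020_nuElimination` (Thm. 6.28: for ONE maximal value `ν ≠ Φ^{(2)}` a
sequence with centres over the stratum `X(ν)`, `H²` non-increasing, killing `ν`), by the gluing of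
Def. 6.14 (p. 84: "Let `ν_1, …, ν_r` be the elements of `Σ_X^max` and assume given a
`ν_i`-elimination … we can glue the `ρ_i` … to get a `Σ^max`-elimination"), in SEQUENTIAL form
over the tree's data type `CentreSeq` (`BlowupSequences.lean`, `BlowupSequencesAppend.lean`):

* `Σ_X(2)` is finite (`Scheme.finite_hsValues_of_isExcellent`, `ψ_X ≤ dim 𝒪_{X,x} ≤ dim X ≤ 2`),
  so the set of its maximal values is finite; none of them is `Φ^{(2)}`, the least value
  (`Scheme.iterPSum_Phi_le_of_mem_hsValues`), since otherwise `Σ_X ⊆ {Φ^{(2)}}` and `X` would be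
  regular (`Scheme.isRegular_iff_hsValues_subset`);
* induction over finite sets `S` of maximal values of `Σ_X(2)` (`exists_centreSeq_killing_finite`):
  having a sequence `t₁` with centres over `{H_X ∈ S}`, `H²` non-increasing, killing `S`, a further
  maximal value `ν₀` either is already absent from `Σ_{t₁.top}` or is maximal there (values of
  `t₁.top` lie below values of `X`); in the latter case the `ν`-fact applied to `t₁.top` — again
  Noetherian (`isNoetherian_top`), reduced (`isReduced_top`), excellent (`isExcellent_top`:
  blow-ups are locally of finite type, and schemes locally of finite type over excellent schemes
  are excellent, Matsumura §32 p. 260 / Stacks 07QU, `isExcellentRing_of_forall_exists_away` +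
  `IsExcellentRing.of_finiteType'`) and of dimension `≤ 2` (`topologicalKrullDim_top_le`) — gives
  `t₂` with centres over `t₁.top(ν₀)`, which maps into `{H_X ∈ insert ν₀ S}` (a point with value
  `ν₀` maps to a point with value `≥ ν₀`, hence `= ν₀` by maximality); the concatenation
  `t₁.append t₂` (`centresOver_append_iff`, `comp_append`, `top_append`) is `H²`-non-increasing
  (`hsFun_append_le`, transporting points along `eqToHom (top_append …)`), and a killed maximal
  value never returns (it would sit below a value of `t₁.top`, forcing it back into `Σ_{t₁.top}`).

## Sources

* V. Cossart, U. Jannsen, S. Saito, LNM 2270 (2020), Def. 6.14, Def. 6.15, Thm. 6.28, Thm. 3.10 (1),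
  Rem. 2.32, Lemma 2.36. [CossartJannsenSaito2020]
* H. Matsumura, *Commutative Ring Theory* (1986), §32 p. 260. [Matsumura1987]
* The Stacks Project, Tag 07QU. [StacksProject]
-/

set_option linter.dupNamespace false -- mandated namespace of this single-conjunct summit

noncomputable section

open CategoryTheory AlgebraicGeometry TopologicalSpace
open Literature.AlgebraicGeometry.Resolution Literature.RingTheory.HilbertSamuel

namespace Summit.ResolutionOfSingularities.ResolutionOfSingularities.Theorems.SigmaMaxModifications.Sketch

universe u

/-! ## Excellence along morphisms locally of finite type and along blow-up sequences -/

/-- **Schemes locally of finite type over an excellent scheme have excellent affine coordinate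
rings** (Matsumura §32 p. 260; Stacks 07QU: "any localization of a finite type ring over an
excellent ring is excellent"): if `f : X → Y` is locally of finite type, `X` is locally Noetherian
and `Y` is excellent, then `Γ(X, V)` is excellent for every affine open `V ⊆ X` — `V` is covered by
basic opens `D(g)` lying over affine opens `U` of `Y`, `Γ(X, D(g)) = Γ(X, V)_g` is of finite type
over the excellent ring `Γ(Y, U)` (`IsExcellentRing.of_finiteType'`), and excellence is local on
`Spec Γ(X, V)` (`isExcellentRing_of_forall_exists_away`). The excellent twin of the tree's
`isQuasiExcellentRing_sections_of_locallyOfFiniteType`.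
[cite: Matsumura1987, §32 p. 260] [cite: StacksProject, Tag 07QU] -/
theorem isExcellentRing_sections_of_locallyOfFiniteType {X Y : Scheme.{u}} (f : X ⟶ Y)
    [LocallyOfFiniteType f] [IsLocallyNoetherian X] (hY : Scheme.IsExcellent Y)
    (V : X.affineOpens) : IsExcellentRing Γ(X, V) := by
  haveI : IsNoetherianRing Γ(X, V) := IsLocallyNoetherian.component_noetherian V
  -- the sections `g` whose basic open lies over an affine open of `Y`
  let s : Set Γ(X, V) := {g | ∃ U : Y.affineOpens, X.basicOpen g ≤ f ⁻¹ᵁ (U : Y.Opens)}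
  have hs : Ideal.span s = ⊤ := by
    rw [← V.2.self_le_iSup_basicOpen_iff]
    intro x hxV
    obtain ⟨U, hU, hxU, -⟩ := exists_isAffineOpen_mem_and_subset (X := Y) (x := f x)
      (U := ⊤) (Opens.mem_top _)
    obtain ⟨g, hgle, hxg⟩ := V.2.exists_basicOpen_le (V := f ⁻¹ᵁ U) ⟨x, hxU⟩ hxV
    exact Opens.mem_iSup.mpr ⟨⟨g, ⟨U, hU⟩, hgle⟩, hxg⟩
  refine isExcellentRing_of_forall_exists_away Γ(X, V) fun p _ => ?_
  -- a `g ∈ s` outside `p`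
  have hex : ∃ g ∈ s, g ∉ p := by
    by_contra h
    push Not at h
    have hle : Ideal.span s ≤ p := Ideal.span_le.mpr h
    rw [hs, top_le_iff] at hle
    exact Ideal.IsPrime.ne_top ‹_› hle
  obtain ⟨g, ⟨U, hU⟩, hgp⟩ := hex
  haveI : IsLocalization.Away g Γ(X, X.basicOpen g) := V.2.isLocalization_basicOpen g
  refine ⟨g, Γ(X, X.basicOpen g), inferInstance, inferInstance, inferInstance, hgp, ?_⟩
  -- `Γ(X, D(g))` is of finite type over the excellent ring `Γ(Y, U)`
  have hft : (f.appLE U (X.basicOpen g) hU).hom.FiniteType :=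
    HasRingHomProperty.appLE (P := @LocallyOfFiniteType) (f := f) inferInstance U
      ⟨_, V.2.basicOpen g⟩ hU
  letI := (f.appLE U (X.basicOpen g) hU).hom.toAlgebra
  haveI : Algebra.FiniteType Γ(Y, U) Γ(X, X.basicOpen g) := hft
  exact (hY U).of_finiteType'

/-- **A locally Noetherian scheme locally of finite type over an excellent scheme is excellent**
(Matsumura §32 p. 260; Stacks 07QU). [cite: Matsumura1987, §32 p. 260] -/
theorem isExcellent_of_locallyOfFiniteType_of_isExcellent {X Y : Scheme.{u}} (f : X ⟶ Y)
    [LocallyOfFiniteType f] [IsLocallyNoetherian X] (hY : Scheme.IsExcellent Y) :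
    Scheme.IsExcellent X :=
  fun V => isExcellentRing_sections_of_locallyOfFiniteType f hY V

/-- **The last scheme of a blow-up sequence over an excellent locally Noetherian scheme is
excellent**: each blow-up is proper, hence locally of finite type, so excellence and local
Noetherianity propagate step by step (CJS p. 85: blow-ups of excellent schemes stay in the class
of excellent schemes). [cite: Matsumura1987, §32 p. 260] -/
theorem isExcellent_top : ∀ {X : Scheme.{u}} [IsLocallyNoetherian X] (s : CentreSeq X),
    Scheme.IsExcellent X → Scheme.IsExcellent s.top
  | _, _, .nil _, h => h
  | _, _, .cons C rest, h => by
    haveI : IsProper (blowup.π C) := (blowup.isBlowup C).isProper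
    haveI : IsLocallyNoetherian (blowup C) := LocallyOfFiniteType.isLocallyNoetherian (blowup.π C)
    show Scheme.IsExcellent rest.top
    exact isExcellent_top rest (isExcellent_of_locallyOfFiniteType_of_isExcellent (blowup.π C) h)

/-- **The last scheme of a blow-up sequence over a Noetherian scheme is Noetherian**: each blow-up
is proper, hence locally of finite type (locally Noetherian source) and quasi-compact (compact
source). [folklore] -/
theorem isNoetherian_top : ∀ {X : Scheme.{u}} [IsNoetherian X] (s : CentreSeq X),
    IsNoetherian s.top
  | X, _, .nil _ => show IsNoetherian X from inferInstance
  | _, _, .cons C rest => by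
    haveI : IsProper (blowup.π C) := (blowup.isBlowup C).isProper
    haveI : IsLocallyNoetherian (blowup C) := LocallyOfFiniteType.isLocallyNoetherian (blowup.π C)
    haveI : CompactSpace (blowup C) := QuasiCompact.compactSpace_of_compactSpace (blowup.π C)
    haveI : IsNoetherian (blowup C) := {}
    show IsNoetherian rest.top
    exact isNoetherian_top rest

/-! ## Hilbert–Samuel functions and values under concatenation of blow-up sequences -/

/-- Transport of points along an equality of schemes does not change the Hilbert–Samuel
function. [folklore] -/
theorem hsFun_eqToHom_base {Y Z : Scheme.{u}} (e : Y = Z) (N : ℕ) (y : Y) :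
    Scheme.hsFun Z N ((eqToHom e).base y) = Scheme.hsFun Y N y := by
  subst e
  rfl

/-- The values `Σ` of the last scheme of a concatenation are those of the last scheme of its
second part (`CentreSeq.top_append`). [folklore] -/
theorem hsValues_top_append {X : Scheme.{u}} (s : CentreSeq X) (t : CentreSeq s.top) (N : ℕ) :
    Scheme.hsValues (s.append t).top N = Scheme.hsValues t.top N := by
  rw [CentreSeq.top_append]

/-- **`H^N` non-increase composes along a concatenation** (CJS Thm. 3.10 (1), iterated form): if
`H^N` does not increase along `s.comp` and along `t.comp`, it does not increase along
`(s.append t).comp = t.comp ≫ s.comp` (`CentreSeq.comp_append`, through `eqToHom (top_append s t)`).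
[cite: CossartJannsenSaito2020, Thm. 3.10 (1)] -/
theorem hsFun_append_le {X : Scheme.{u}} (s : CentreSeq X) (t : CentreSeq s.top) (N : ℕ)
    (hs : ∀ y : s.top, Scheme.hsFun s.top N y ≤ Scheme.hsFun X N (s.comp.base y))
    (ht : ∀ z : t.top, Scheme.hsFun t.top N z ≤ Scheme.hsFun s.top N (t.comp.base z))
    (z : (s.append t).top) :
    Scheme.hsFun (s.append t).top N z ≤ Scheme.hsFun X N ((s.append t).comp.base z) := by
  rw [CentreSeq.comp_append, Scheme.Hom.comp_apply, Scheme.Hom.comp_apply,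
    ← hsFun_eqToHom_base (CentreSeq.top_append s t) N z]
  exact (ht _).trans (hs _)

/-! ## The induction over finitely many maximal values (CJS Def. 6.14, sequential gluing) -/

/-- **Sequential gluing of `ν`-eliminations (CJS Def. 6.14), the induction.** Let `Y` be a reduced
excellent Noetherian scheme of dimension `≤ 2` and assume `ν`-eliminations exist
(`CossartJannsenSaito2020_nuElimination`). For every finite set `S` of maximal values of `Σ_Y(2)`
none of which is `Φ^{(2)}` there is a blow-up sequence `t : CentreSeq Y` with centres over
`{y | H_Y(y) ∈ S}`, along whose composite `H²` does not increase, and after which no `ν ∈ S` is a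
value. Step: a further maximal `ν₀` still present on `t₁.top` is maximal there (values of `t₁.top`
lie below values of `Y`); eliminate it on `t₁.top` (Noetherian, reduced, excellent, `dim ≤ 2`) and
concatenate; killed maximal values never return. [cite: CossartJannsenSaito2020, Def. 6.14, Thm. 6.28] -/
theorem exists_centreSeq_killing_finite (hν : CossartJannsenSaito2020_nuElimination.{u})
    {Y : Scheme.{u}} [IsNoetherian Y] [IsReduced Y] (hexc : Scheme.IsExcellent Y)
    (hdim : topologicalKrullDim Y ≤ 2) (S : Set (ℕ → ℕ)) (hSfin : S.Finite)
    (hS : ∀ ν ∈ S, Maximal (· ∈ Scheme.hsValues Y 2) ν)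
    (hΦ : ∀ ν ∈ S, ν ≠ iterPSum 2 Phi) :
    ∃ t : CentreSeq Y, t.CentresOver {y | Scheme.hsFun Y 2 y ∈ S} ∧
      (∀ y' : t.top, Scheme.hsFun t.top 2 y' ≤ Scheme.hsFun Y 2 (t.comp.base y')) ∧
      ∀ ν ∈ S, ν ∉ Scheme.hsValues t.top 2 := by
  induction S, hSfin using Set.Finite.induction_on with
  | empty =>
    exact ⟨CentreSeq.nil Y, trivial, fun _ => le_rfl, fun ν hν => absurd hν (Set.notMem_empty ν)⟩
  | @insert ν₀ S _ _ ih =>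
    obtain ⟨t₁, hover₁, hmono₁, hkill₁⟩ :=
      ih (fun ν hν => hS ν (Set.mem_insert_of_mem ν₀ hν))
        (fun ν hν => hΦ ν (Set.mem_insert_of_mem ν₀ hν))
    have hν₀ : Maximal (· ∈ Scheme.hsValues Y 2) ν₀ := hS ν₀ (Set.mem_insert ν₀ S)
    -- along `t₁.comp`, a point with value `≥` a maximal value `μ` of `Σ_Y` has value `μ`, and so
    -- does its image
    have key : ∀ {μ : ℕ → ℕ}, Maximal (· ∈ Scheme.hsValues Y 2) μ → ∀ y : t₁.top,
        μ ≤ Scheme.hsFun t₁.top 2 y →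
        Scheme.hsFun t₁.top 2 y = μ ∧ Scheme.hsFun Y 2 (t₁.comp.base y) = μ := by
      intro μ hμ y hle
      have h1 : μ ≤ Scheme.hsFun Y 2 (t₁.comp.base y) := hle.trans (hmono₁ y)
      have h2 : Scheme.hsFun Y 2 (t₁.comp.base y) ≤ μ := hμ.2 ⟨t₁.comp.base y, rfl⟩ h1
      exact ⟨le_antisymm ((hmono₁ y).trans h2) hle, le_antisymm h2 h1⟩
    have hsub : {y : Y | Scheme.hsFun Y 2 y ∈ S} ⊆ {y | Scheme.hsFun Y 2 y ∈ insert ν₀ S} :=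
      fun y hy => Set.mem_insert_of_mem ν₀ hy
    by_cases hmem : ν₀ ∈ Scheme.hsValues t₁.top 2
    · -- `ν₀` is still a value of `t₁.top`: it is maximal there; eliminate it on `t₁.top`
      have hmax : Maximal (· ∈ Scheme.hsValues t₁.top 2) ν₀ := by
        refine ⟨hmem, fun μ hμ hle => ?_⟩
        obtain ⟨y, rfl⟩ := hμ
        exact (key hν₀ y hle).1.le
      haveI : IsNoetherian t₁.top := isNoetherian_top t₁
      haveI : IsReduced t₁.top := isReduced_top t₁
      have hexc₁ : Scheme.IsExcellent t₁.top := isExcellent_top t₁ hexc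
      have hdim₁ : topologicalKrullDim t₁.top ≤ 2 := by
        have h := topologicalKrullDim_top_le t₁ (N := 2) (by exact_mod_cast hdim)
        exact_mod_cast h
      obtain ⟨t₂, hover₂, hmono₂, hkill₂⟩ :=
        hν t₁.top hexc₁ hdim₁ ν₀ hmax (hΦ ν₀ (Set.mem_insert ν₀ S))
      refine ⟨t₁.append t₂, ?_, hsFun_append_le t₁ t₂ 2 hmono₁ hmono₂, fun ν hν' => ?_⟩
      · -- centres: those of `t₁` lie over `{H ∈ S}`, those of `t₂` over `t₁.top(ν₀) ⊆ comp⁻¹ {H = ν₀}`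
        rw [CentreSeq.centresOver_append_iff]
        refine ⟨CentreSeq.CentresOver.mono t₁ hsub hover₁,
          CentreSeq.CentresOver.mono t₂ (fun y hy => ?_) hover₂⟩
        have hy' : Scheme.hsFun t₁.top 2 y = ν₀ := hy
        show Scheme.hsFun Y 2 (t₁.comp.base y) ∈ insert ν₀ S
        rw [(key hν₀ y hy'.symm.le).2]
        exact Set.mem_insert ν₀ S
      · -- no value of `insert ν₀ S` survives
        rw [hsValues_top_append]
        rcases Set.mem_insert_iff.mp hν' with rfl | hνS
        · exact hkill₂
        · rintro ⟨z, hz⟩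
          have h1 : ν ≤ Scheme.hsFun t₁.top 2 (t₂.comp.base z) := hz.symm.le.trans (hmono₂ z)
          exact hkill₁ ν hνS ⟨t₂.comp.base z, (key (hS ν hν') _ h1).1⟩
    · -- `ν₀` is already gone on `t₁.top`: keep `t₁`
      refine ⟨t₁, CentreSeq.CentresOver.mono t₁ hsub hover₁, hmono₁, fun ν hν' => ?_⟩
      rcases Set.mem_insert_iff.mp hν' with rfl | hνS
      · exact hmem
      · exact hkill₁ ν hνS

/-! ## The stub -/

/-- **The glued CJS fact from the `ν`-wise one** (Cossart–Jannsen–Saito 2020, Def. 6.14, p. 84: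
"Let `ν_1, …, ν_r` be the elements of `Σ_X^max` and assume given a `ν_i`-elimination … we can glue
the `ρ_i` … to get a `Σ^max`-elimination"; Def. 6.15; Thm. 6.28). For `X` reduced, excellent,
Noetherian, of dimension `≤ 2` and not regular: `Σ_X(2)` is finite
(`Scheme.finite_hsValues_of_isExcellent`), so its maximal values form a finite set; none is
`Φ^{(2)}` (the least value, `Scheme.iterPSum_Phi_le_of_mem_hsValues`; else `Σ_X ⊆ {Φ^{(2)}}` and
`X` would be regular, `Scheme.isRegular_iff_hsValues_subset`); the sequential gluing
`exists_centreSeq_killing_finite` over that set yields a blow-up sequence with centres over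
`{x | H_X(x) maximal} = X_max(2)`, `H²` non-increasing, killing every maximal value. Makes
`CossartJannsenSaito2020_nuElimination` (Thm. 6.28, the monograph's primitive) the only CJS debt
of the line. [cite: CossartJannsenSaito2020, Def. 6.14, Def. 6.15, Thm. 6.28] -/
theorem stub_sigmaMaxElimination_of_nuElimination :
    CossartJannsenSaito2020_nuElimination.{0} → CossartJannsenSaito2020_sigmaMaxElimination.{0} := by
  intro hν X _ _ hexc hdim hreg
  have hstalk : ∀ x : X, ∃ d : ℕ, ringKrullDim (X.presheaf.stalk x) = d ∧ d ≤ 2 := fun x =>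
    exists_ringKrullDim_stalk_eq_of_topologicalKrullDim_le (N := 2) (by exact_mod_cast hdim) x
  have hψ : ∀ x : X, Scheme.hsPsi X x ≤ 2 := fun x => by
    obtain ⟨d, hd, hd2⟩ := hstalk x
    exact (Scheme.hsPsi_le x hd).trans hd2
  have hfin : (Scheme.hsValues X 2).Finite := Scheme.finite_hsValues_of_isExcellent hexc 2 hψ
  have hMfin : {ν | Maximal (· ∈ Scheme.hsValues X 2) ν}.Finite := hfin.subset fun ν hν => hν.1
  -- no maximal value is `Φ^{(2)}`: otherwise `Σ_X ⊆ {Φ^{(2)}}` and `X` would be regular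
  have hΦ : ∀ ν : ℕ → ℕ, Maximal (· ∈ Scheme.hsValues X 2) ν → ν ≠ iterPSum 2 Phi := by
    intro ν hν hνΦ
    subst hνΦ
    refine hreg ((Scheme.isRegular_iff_hsValues_subset hstalk).mpr fun μ hμ => ?_)
    have h1 : iterPSum 2 Phi ≤ μ := Scheme.iterPSum_Phi_le_of_mem_hsValues hμ
    exact le_antisymm (hν.2 hμ h1) h1
  obtain ⟨t, hover, hmono, hkill⟩ :=
    exists_centreSeq_killing_finite hν hexc hdim {ν | Maximal (· ∈ Scheme.hsValues X 2) ν} hMfin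
      (fun ν hν => hν) hΦ
  exact ⟨t, CentreSeq.CentresOver.mono t (fun x hx => hx) hover, hmono, fun ν hν => hkill ν hν⟩

end Summit.ResolutionOfSingularities.ResolutionOfSingularities.Theorems.SigmaMaxModifications.Sketch

end
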